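import Summits.ABC.IUTFork.LanaStrips
import Summits.ABC.IUTFork.LanaThetaLink
import HarnessLib

/-!
# L-LANA objects IX: Hodge theaters (as carriers of strips), log-links, log sequences, the big-H diagram (LANA §4.2 (a), §5.3, §7.2, §8.1)

Record-only file (D-0012) of the abc-iut cell (seat abc-iut-c312-4, L-LANA level, plan/LLANA-SPEC N12 and
the indexed-family half of N16); TAKES NO SIDE on [IUTchIII] Cor. 3.12. Over the prime-strips of
`LanaStrips.lean` and the Θ-link of `LanaThetaLink.lean`, it types, from Project LANA's interim report
(bib `LANA2026Report`, read on the page):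

* §4.2 (a) p. 25: "a Hodge theater consists of many pieces of GM-data together with the relations among
  them … we call the underlying structure of a Hodge theater obtained by considering only the étale-like
  portions of these pieces of GM-data an étale Hodge theater [`HT^D`]" — INTERFACE `HodgeTheater`: the
  holomorphic local data (an `F`-prime-strip), its `q`-pilot and Θ-pilot BPSs (§4.2 (c), §7.1 (a)) on the
  common étale-unit BPS `B(H)`; `HodgeTheater.D` = the `D`-prime-strip of étale-like portions.
* §5.3 (a) p. 29: "We fix an isomorphism `†HT^D ⥲ ‡HT^D` between the étale-like portions of the Hodge
  theaters once for all. Then by the fact ([IUTchI, Cor. 5.3 (ii), p. 160]) that any isomorphism of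
  `D`-prime strips can be uniquely lifted to an isomorphism of `F`-prime strips, one obtains a unique lift
  `log : †K̄_v(logF) ⥲ ‡K̄_v`. We call this isomorphism a log-link" — `LogLink` (the fixed étale
  isomorphism with a lift to the `F`-prime-strips), the cited unique-lifting property as the HYPOTHESIS
  `UniqueLifting` ([IUTchI] Cor. 5.3 (ii), claim), `LogLink.lift_unique`.
* §5.3 (b) p. 30 + Notation 5.3.2: "a collection of copies of Hodge theaters `{ⁿHT}_{n∈ℤ}` … for each
  `n ∈ ℤ`, fix once for all an isomorphism `ⁿHT^D ⥲ ⁿ⁺¹HT^D` … a sequence of log-links … we will simply identify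
  all `ⁿHT^D` for `n ∈ ℤ`, and write them as a single symbol `°HT^D`" — `LogSequence`, `LogSequence.identify`
  (the composite identifications `ⁿHT^D ⥲ ⁿ⁺ᵏHT^D`, DEFINED).
* §7.2 (a) p. 38 / Fig. 4 p. 39 + §8.1 (g) p. 41: "The big-H diagram is a diagram … consisting of two log
  sequences and a horizontal Θ-link connecting them"; "for every integer `m`, one places a Θ-link
  `⁰'ᵐHT → ¹'ᵐHT`" — `BigH` (left column = Θ-pilot side, right column = `q`-pilot side, a Θ-link at every
  level), `BigH.thetaLink`, `thetaLink_gluing_nonempty` (Rem. 8.2.1 at every level), `BigH.unitIdentification`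
  (§8.1 (d): "under the Θ-link, the unit group portions `⁰'⁰O^{×μ}_v` and `¹'⁰O^{×μ}_v` are identified" — by
  each member of the gluing).

Modelling notes. (i) The GLOBAL components of an étale Hodge theater (§4.2 (a) (1): `π₁(C_K)`, `π₁(X_K)`)
and the `Θ^{±ell}NF`-structure are not modelled ([IUTchI] §4–6; seats abc-iut-L5-t3/t4): a Hodge theater
here is only what LANA's §5–§8 use of it — a carrier of strips and pilots. (ii) The log-link's effect on
Frobenius-like data (`log : O^{×μ} ⥲ K̄_v(logF)`, the "new multiplication", §5.1 (a)) needs the `p`-adic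
logarithm (LLANA-SPEC N10 (HF); seats abc-iut-S1 / L4-t2) and is NOT typed: at this level a log-link is its
étale identification plus the lifted strip isomorphism. (iii) §7.2 (a): "Note that the Θ-link cannot extend
to an isomorphism of Hodge theaters" is not statable at this level (no ring structure is carried).
NOT here: log-shell transport along the columns (Fig. 5, (Ind3)), any judgement.
-/

noncomputable section

namespace Summit.ABC
namespace IUTFork

variable {V : Type} {ref : V → RefLocalDatum} [Fintype V] {bad : Finset V}

/-! ## 0. Groupoid structure on isomorphisms of `D`-prime-strips -/

namespace DPrimeStrip.Iso

/-- Identity. [folklore] -/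
protected def refl (D : DPrimeStrip ref) : D.Iso D := fun v => ContinuousMulEquiv.refl (D.P v)
/-- Inverse. [folklore] -/
protected def symm {D D' : DPrimeStrip ref} (δ : D.Iso D') : D'.Iso D := fun v => (δ v).symm
/-- Composite. [folklore] -/
protected def trans {D D' D'' : DPrimeStrip ref} (δ : D.Iso D') (δ' : D'.Iso D'') : D.Iso D'' :=
  fun v => (δ v).trans (δ' v)

end DPrimeStrip.Iso

/-! ## 1. Hodge theaters as carriers of strips and pilots (§4.2 (a), interface) -/

variable (ref bad) in
/-- **INTERFACE (§4.2 (a) p. 25; modelling note (i))**: a Hodge theater, as far as LANA §5–§8 use it — its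
holomorphic Frobenius-like local data `{Π_v ↷ O^▷_v}_v` (an `F`-prime-strip), and its `q`-pilot (§4.2 (c))
and Θ-pilot (§7.1 (a)) BPSs on the common étale-unit BPS `B(H)` ("one can construct an étale-unit BPS `B(H)`
from the objects that is reconstructed from `H`", p. 26), with equal product formulas (Rem. 4.1.5).
[cite: LANA2026Report, §4.2 (a) p. 25, §4.2 (c) p. 26, §7.1 (a) pp. 37–38] -/
structure HodgeTheater : Type 1 where
  /-- the `F`-prime-strip of `HT` -/
  F : FPrimeStrip ref
  /-- the `q`-pilot BPS of `HT` -/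
  qBPS : LanaBPS (refUnitMu ref) bad
  /-- the Θ-pilot BPS of `HT` -/
  thetaBPS : LanaBPS (refUnitMu ref) bad
  /-- both pilots sit on the étale-unit BPS `B(H)` of the Hodge theater -/
  unit_eq : thetaBPS.unit = qBPS.unit
  /-- equal product formulas (Rem. 4.1.5; XIV `thetaBPS_PF` for the printed pilots) -/
  PF_eq : thetaBPS.val.PF = qBPS.val.PF

namespace HodgeTheater

/-- The étale-like portion `HT^D` (here: the `D`-prime-strip `{Π_v}` underlying the `F`-prime-strip).
[cite: LANA2026Report, §4.2 (a) p. 25] -/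
def D (H : HodgeTheater ref bad) : DPrimeStrip ref := H.F.toD

/-- The étale-unit BPS `B(H)` of the Hodge theater. [cite: LANA2026Report, §4.2 (c) p. 26] -/
def unitBPS (H : HodgeTheater ref bad) : EtaleUnitBPS (refUnitMu ref) := H.qBPS.unit

end HodgeTheater

/-! ## 2. Log-links (§5.3 (a)) -/

variable (ref) in
/-- **HYPOTHESIS, RELATIVE TO THE REFERENCE DATA `ref` ([IUTchI] Cor. 5.3 (ii) p. 160, as used by LANA
§5.3 (a) p. 29)**: "any isomorphism of `D`-prime strips can be uniquely lifted to an isomorphism of `F`-prime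
strips". This is ANABELIAN content about the real objects (`Π_v` the arithmetic fundamental group of a
hyperbolic curve, [AbsTopIII] Thm. 1.9); it is stated here as a property of `ref` in the model-relative form
(a junk `ref` — e.g. the `ℚ_p` witness with `Π_v := G_v` of `LanaGoodPlace.padicRef` — is expected to make it
FALSE, and nothing below uses it except as an explicit hypothesis `hU`). Never to be asserted; to be
DISCHARGED only for reference data built from L3-t2/L4-t1's curve interfaces.
[claim: Mochizuki2012, status: disputed] [cite: LANA2026Report, §5.3 (a) p. 29] -/
@[cite "LANA2026Report" "§5.3 (a) p. 29"]
def UniqueLifting : Prop :=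
  ∀ (F F' : FPrimeStrip ref) (δ : F.toD.Iso F'.toD), ∃! Φ : F.Iso F', ∀ v, (Φ v).eG = δ v

/-- **LANA §5.3 (a), the log-link `log : †HT → ‡HT`**: "We fix an isomorphism `†HT^D ⥲ ‡HT^D` between the
étale-like portions of the Hodge theaters once for all" together with its lift to the `F`-prime-strips (whose
uniqueness is `UniqueLifting`); the induced `log : †K̄_v(logF) ⥲ ‡K̄_v` on Frobenius-like data is modelling
note (ii). [cite: LANA2026Report, §5.3 (a) pp. 29–30] -/
structure LogLink (H H' : HodgeTheater ref bad) : Type where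
  /-- the fixed isomorphism of étale-like portions `†HT^D ⥲ ‡HT^D` -/
  etaleIso : H.D.Iso H'.D
  /-- a lift to the `F`-prime-strips -/
  lift : H.F.Iso H'.F
  /-- the lift lies over the étale isomorphism -/
  lift_etale : ∀ v, (lift v).eG = etaleIso v

/-- Under `UniqueLifting` the log-link is determined by its étale isomorphism ("one obtains a unique
lift"). [cite: LANA2026Report, §5.3 (a) p. 29] -/
theorem LogLink.lift_unique (hU : UniqueLifting ref) {H H' : HodgeTheater ref bad} (L L' : LogLink H H')
    (h : L.etaleIso = L'.etaleIso) : L.lift = L'.lift := by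
  obtain ⟨Φ, -, huniq⟩ := hU H.F H'.F L.etaleIso
  rw [huniq L.lift L.lift_etale, huniq L'.lift (fun v => by rw [L'.lift_etale, h])]

/-! ## 3. Log sequences (§5.3 (b), Notation 5.3.2) -/

variable (ref bad) in
/-- **LANA §5.3 (b)**: "a collection of copies of Hodge theaters `{ⁿHT}_{n∈ℤ}` indexed by integers, and for
each `n ∈ ℤ`, fix once for all an isomorphism `ⁿHT^D ⥲ ⁿ⁺¹HT^D` … one obtains a sequence of log-links
`⋯ → ⁻¹HT → ⁰HT → ¹HT → ⋯`, which we call a log sequence." [cite: LANA2026Report, §5.3 (b) p. 30] -/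
structure LogSequence : Type 1 where
  /-- `ⁿHT` -/
  HT : ℤ → HodgeTheater ref bad
  /-- `log : ⁿHT → ⁿ⁺¹HT` -/
  link : ∀ n : ℤ, LogLink (HT n) (HT (n + 1))

namespace LogSequence

variable (S : LogSequence ref bad)

/-- Transport of the étale-like portion along an equality of indices (bookkeeping for `ℤ`-indexing).
[folklore] -/
def isoOfEq {m m' : ℤ} (h : m = m') : (S.HT m).D.Iso (S.HT m').D := by
  subst h
  exact DPrimeStrip.Iso.refl _

/-- **Notation 5.3.2**: "we will simply identify all `ⁿHT^D` for `n ∈ ℤ`, and write them as a single symbol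
`°HT^D`" — the composite identification `ⁿHT^D ⥲ ⁿ⁺ᵏHT^D` along the fixed isomorphisms (DEFINED by
composition). [cite: LANA2026Report, Notation 5.3.2 p. 30] -/
def identify (n : ℤ) : ∀ k : ℕ, (S.HT n).D.Iso (S.HT (n + k)).D
  | 0 => S.isoOfEq (by simp)
  | k + 1 => ((identify n k).trans (S.link (n + k)).etaleIso).trans (S.isoOfEq (by push_cast; ring))

/-- Rem. 5.3.1: every member `ᵏHT^D` (`k ≥ 0`; symmetrically below `0`) is identified with `⁰HT^D` — the
étale-like data "can transcend the walls of log-links and be shared". [cite: LANA2026Report, Rem. 5.3.1 p. 30] -/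
def toLevel (k : ℕ) : (S.HT 0).D.Iso (S.HT k).D := (S.identify 0 k).trans (S.isoOfEq (by simp))

end LogSequence

/-! ## 4. The big-H diagram (§7.2 (a), Fig. 4; §8.1 (g)) -/

variable (ref bad) in
/-- **LANA §7.2 (a) / Fig. 4 with the ladder of §8.1 (g)**: "The big-H diagram is a diagram (a subdiagram of
the log-theta-lattice) consisting of two log sequences and a horizontal Θ-link connecting them"; "for every
integer `m`, one places a Θ-link `⁰'ᵐHT → ¹'ᵐHT` between `⁰'ᵐHT` and `¹'ᵐHT`". The left column carries the
Θ-pilots, the right column the `q`-pilots (§7.2 (a)); a Θ-link at level `m` is the datum that the product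
formulas agree (then the gluing is the full poly-isomorphism, `LanaThetaLink`).
[cite: LANA2026Report, §7.2 (a) p. 38, §8.1 (g) p. 41] -/
structure BigH : Type 1 where
  /-- the column `⁰'*HT` (domain side of the Θ-links) -/
  left : LogSequence ref bad
  /-- the column `¹'*HT` (codomain side) -/
  right : LogSequence ref bad
  /-- Θ-link at every level: equal product formulas of `⁰'ᵐB_Θ` and `¹'ᵐB_q` -/
  PF_eq : ∀ m : ℤ, ((left.HT m).thetaBPS).val.PF = ((right.HT m).qBPS).val.PF

namespace BigH

variable (B : BigH ref bad)

/-- The Θ-link at level `m`: `⁰'ᵐB_Θ → ¹'ᵐB_q` (its gluing = all BPS-isomorphisms, `ThetaLink.gluing`).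
[cite: LANA2026Report, §7.2 (a) p. 38, §8.1 (g) p. 41] -/
def thetaLink (m : ℤ) : ThetaLink (refUnitMu ref) bad :=
  ⟨(B.left.HT m).thetaBPS, (B.right.HT m).qBPS, B.PF_eq m⟩

/-- Every Θ-link of the ladder has nonempty gluing (Rem. 8.2.1 at every level).
[cite: LANA2026Report, Rem. 8.2.1 p. 42] -/
theorem thetaLink_gluing_nonempty (m : ℤ) : (B.thetaLink m).gluing.Nonempty :=
  (B.thetaLink m).gluing_nonempty

/-- **§8.1 (d)**: "under the Θ-link, the unit group portions `⁰'⁰O^{×μ}_v` and `¹'⁰O^{×μ}_v` are identified" —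
each member of the gluing at level `m` identifies the étale-unit BPSs `B(⁰'ᵐHT) ⥲ B(¹'ᵐHT)` of the two Hodge
theaters. [cite: LANA2026Report, §8.1 (d) p. 40] -/
def unitIdentification (m : ℤ) (Φ : (B.thetaLink m).gluing) :
    (B.left.HT m).unitBPS.Iso (B.right.HT m).unitBPS := by
  have e := (B.thetaLink m).gluingEquivUnit Φ
  change (B.left.HT m).thetaBPS.unit.Iso (B.right.HT m).qBPS.unit at e
  rw [(B.left.HT m).unit_eq] at e
  exact e

/-- **§7.1 (b) (a) along the ladder**: each gluing member induces the coric identification of the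
`D^⊢`-prime-strips (étale portions `{G_v}`) of the two sides. [cite: LANA2026Report, §7.1 (b) (a) p. 38] -/
def etaleIdentification (m : ℤ) (Φ : (B.thetaLink m).gluing) :
    (B.left.HT m).thetaBPS.unit.etale.Iso (B.right.HT m).qBPS.unit.etale :=
  (B.thetaLink m).etalePart Φ.1

end BigH

/-! ## 5. Appendix: the lifting map of §5.3 (a) under `UniqueLifting`; concordance for the [IUTchI] Cor. 5.3 locator -/

/-- **§5.3 (a), "one obtains a unique lift `log`"**: under `UniqueLifting`, every fixed isomorphism of
étale-like portions `δ : †HT^D ⥲ ‡HT^D` carries a log-link over it — DEFINED as the unique lift (uniqueness is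
`LogLink.lift_unique`). CONCORDANCE (referee abc-iut-ref-b, PASS-B5 I3): LANA's locator "[10, Cor. 5.3 (ii),
p. 160]" (PRIMS pagination) is, in the kurims manuscript of [IUTchI] (May 2020, the cell's page convention),
p. 143 l. 47 – p. 144 l. 15, read on the page: Cor. 5.3 (ii) "let `ⁱF` be an `F`-prime-strip; `ⁱD` the
`D`-prime-strip associated to `ⁱF` … Then the natural map `Isom(¹F, ²F) → Isom(¹D, ²D)` … is bijective". NOTE:
Cor. 5.3 (iii) (kurims p. 144 l. 16–19), the mono-analytic analogue for `F^⊢`-prime-strips, asserts only that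
`Isom(¹F^⊢, ²F^⊢) → Isom(¹D^⊢, ²D^⊢)` "is surjective"; `UniqueLifting` is the holomorphic, (ii)-level statement
and is not to be cited for `⊢`-level bijectivity. [claim: Mochizuki2012, status: disputed]
[cite: LANA2026Report, §5.3 (a) p. 29] -/
def LogLink.ofEtaleIso (hU : UniqueLifting ref) {H H' : HodgeTheater ref bad} (δ : H.D.Iso H'.D) :
    LogLink H H' where
  etaleIso := δ
  lift := Classical.choose (hU H.F H'.F δ).exists
  lift_etale := Classical.choose_spec (hU H.F H'.F δ).exists

/-- The constructed log-link lies over the given étale isomorphism. [cite: LANA2026Report, §5.3 (a) p. 29] -/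
@[simp] theorem LogLink.ofEtaleIso_etaleIso (hU : UniqueLifting ref) {H H' : HodgeTheater ref bad}
    (δ : H.D.Iso H'.D) : (LogLink.ofEtaleIso hU δ).etaleIso = δ := rfl

/-- **Uniqueness of the log-link over a fixed étale isomorphism**: the lift of ANY log-link is the lift
constructed from its étale isomorphism ("a unique lift", §5.3 (a); [IUTchI] Cor. 5.3 (ii), kurims p. 144).
[cite: LANA2026Report, §5.3 (a) p. 29] -/
theorem LogLink.lift_eq_ofEtaleIso (hU : UniqueLifting ref) {H H' : HodgeTheater ref bad} (L : LogLink H H') :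
    L.lift = (LogLink.ofEtaleIso hU L.etaleIso).lift :=
  LogLink.lift_unique hU L (LogLink.ofEtaleIso hU L.etaleIso) rfl

variable (ref bad) in
/-- **§5.3 (b), the log sequence from the fixed étale isomorphisms**: "for each `n ∈ ℤ`, fix once for all an
isomorphism `ⁿHT^D ⥲ ⁿ⁺¹HT^D` … Then by considering the log-link associated to this isomorphism, one obtains a
sequence of log-links `⋯ → ⁻¹HT → ⁰HT → ¹HT → ⋯`" — DEFINED under `UniqueLifting` from the copies `ⁿHT` and the
fixed isomorphisms alone. [cite: LANA2026Report, §5.3 (b) p. 30] -/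
def LogSequence.ofEtaleIsos (hU : UniqueLifting ref) (HT : ℤ → HodgeTheater ref bad)
    (δ : ∀ n : ℤ, (HT n).D.Iso (HT (n + 1)).D) : LogSequence ref bad where
  HT := HT
  link n := LogLink.ofEtaleIso hU (δ n)

/-- The log sequence so obtained has the prescribed étale identifications `ⁿHT^D ⥲ ⁿ⁺¹HT^D` (so its
`identify`/`toLevel` of Notation 5.3.2 are the composites of the fixed isomorphisms).
[cite: LANA2026Report, §5.3 (b) p. 30, Notation 5.3.2 p. 30] -/
@[simp] theorem LogSequence.ofEtaleIsos_link_etaleIso (hU : UniqueLifting ref) (HT : ℤ → HodgeTheater ref bad)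
    (δ : ∀ n : ℤ, (HT n).D.Iso (HT (n + 1)).D) (n : ℤ) :
    ((LogSequence.ofEtaleIsos ref bad hU HT δ).link n).etaleIso = δ n := rfl

end IUTFork

end Summit.ABC

end
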